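import Mathlib
import HarnessLib
import Literature.MathematicalPhysics.StatisticalMechanics.TorusPolymers
import Literature.MathematicalPhysics.StatisticalMechanics.TorusBlocks
import Literature.MathematicalPhysics.StatisticalMechanics.TorusNeighbourhoods
import Literature.MathematicalPhysics.StatisticalMechanics.PolymerExpansion
import Literature.Barriers.CriticalPhenomena.RigorousRGSmallParameterPolymers

/-!
# Translations of the torus paving: the block lattice `(sℤ)^d` acts on blocks, polymers,
# connected sets and components

Geometric facts about the paving of `Λ = (ℤ/M)^d` by centred blocks of odd side `s`
(`TorusPolymer.blockOf`) under the translations `τ_a`, `a ∈ (L^kℤ)^d`, of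
Adams–Buchholz–Kotecký–Müller ([ABKM19] Ch. 6.2: translation invariance of functionals,
Ch. 6.3: translation invariance of the reblocking map `π`, Lemma 6.4 (1)).  Connectedness is
`ℓ^∞`-connectedness (`|x_{i+1} − x_i|_∞ = 1`) from the tree's polymer library
`Literature.Barriers.CriticalPhenomena.LongRangePhi4.Polymer` (`AdjInf`, `ConnIn`, `IsConn`,
`comp`, `components`; same site type `Fin d → ZMod M`).

* `translate a X = X + a`; unions, differences, inclusions, cardinality, `biUnion` commute with it;
* `AdjInf`, `ConnIn`, `IsConn`, `comp`, `components` are translation invariant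
  (`adjInf_add_iff`, `connIn_translate_iff`, `isConn_translate`, `comp_translate`,
  `components_translate`);
* `IsLatticeVec s a` — `a ∈ (sℤ)^d`; closed under `0, +, −`, `(s'ℤ)^d ⊆ (sℤ)^d` for `s ∣ s'`;
  **a non-zero lattice vector has `|a|_∞ ≥ s`** (`le_supNorm_of_isLatticeVec`, `M = s·t`);
* **the block index under a lattice translation** (`resIndex_add_latticeVec`, `M = s·t`, `s, t`
  odd): `b ↦ (b + n) mod t` (balanced) — whole blocks go to whole blocks; hence
  `B_{x+a} = B_x + a` (`blockOf_add`), translates of polymers are polymers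
  (`isPolymer_translate`), `𝓑_k(X + a) = 𝓑_k(X) + a` (`blocks_translate`,
  `card_blocks_translate`), and the closure commutes with coarse translations
  (`closure_translate`).

Everything is proved; no named fact.  The companion file `TorusPolymerConnectivity` proves that
blocks are connected, bounds the diameter of connected sets, and deduces that `(L^{k+1}ℤ)^d` acts
freely on small `k`-polymers.

## References
* S. Adams, S. Buchholz, R. Kotecký, S. Müller, arXiv:1910.13564, Ch. 6.2 (translations `τ_a`,
  `a ∈ (L^kℤ)^d`), Ch. 6.3 (translation invariance of `π`, Lemma 6.4 (1))
  [AdamsBuchholzKoteckyMuller2019].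
* S. Adams, R. Kotecký, S. Müller, arXiv:1606.09541, Ch. 4 [AdamsKoteckyMuller2016].
-/

noncomputable section

namespace Literature.MathematicalPhysics.StatisticalMechanics.TorusPolymer

open scoped BigOperators Classical
open Finset
open Literature.MathematicalPhysics.StatisticalMechanics.GradientFRD
  (natAbs_valMinAbs_le_supNorm supNorm_add_le supNorm_neg supNorm_eq_zero_iff)
open Literature.Barriers.CriticalPhenomena.LongRangePhi4.Polymer
  (AdjInf ConnIn IsConn comp components mem_comp comp_subset mem_comp_self)

variable {d M : ℕ}

/-! ## Translations -/

/-- The translate `X + a = {x + a : x ∈ X}` of a set of torus points (`τ_a` of [ABKM19] Ch. 6.2).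
[cite: AdamsBuchholzKoteckyMuller2019, Ch. 6.2] -/
def translate (a : Fin d → ZMod M) (X : Finset (Fin d → ZMod M)) : Finset (Fin d → ZMod M) :=
  X.image fun x => x + a

/-- Membership in a translate. [cite: AdamsBuchholzKoteckyMuller2019, Ch. 6.2] -/
theorem mem_translate {a : Fin d → ZMod M} {X : Finset (Fin d → ZMod M)} {y : Fin d → ZMod M} :
    y ∈ translate a X ↔ y - a ∈ X := by
  rw [translate, mem_image]
  constructor
  · rintro ⟨x, hx, rfl⟩; simpa using hx
  · intro h; exact ⟨y - a, h, sub_add_cancel y a⟩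

/-- `x + a ∈ X + a ↔ x ∈ X`. [cite: AdamsBuchholzKoteckyMuller2019, Ch. 6.2] -/
theorem add_mem_translate_iff {a : Fin d → ZMod M} {X : Finset (Fin d → ZMod M)} {x : Fin d → ZMod M} :
    x + a ∈ translate a X ↔ x ∈ X := by
  rw [mem_translate, add_sub_cancel_right]

/-- `(X + a) + b = X + (a + b)`. [cite: AdamsBuchholzKoteckyMuller2019, Ch. 6.2] -/
theorem translate_translate (a b : Fin d → ZMod M) (X : Finset (Fin d → ZMod M)) :
    translate b (translate a X) = translate (a + b) X := by
  ext y; simp only [mem_translate, sub_sub, add_comm b a]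

/-- `X + 0 = X`. [cite: AdamsBuchholzKoteckyMuller2019, Ch. 6.2] -/
@[simp] theorem translate_zero (X : Finset (Fin d → ZMod M)) : translate 0 X = X := by
  ext y; simp [mem_translate]

/-- `∅ + a = ∅`. [cite: AdamsBuchholzKoteckyMuller2019, Ch. 6.2] -/
@[simp] theorem translate_empty (a : Fin d → ZMod M) : translate a (∅ : Finset (Fin d → ZMod M)) = ∅ := by
  simp [translate]

/-- Translation is injective on sets. [cite: AdamsBuchholzKoteckyMuller2019, Ch. 6.2] -/
theorem translate_inj {a : Fin d → ZMod M} {X Y : Finset (Fin d → ZMod M)}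
    (h : translate a X = translate a Y) : X = Y := by
  have := congrArg (translate (-a)) h
  rwa [translate_translate, translate_translate, add_neg_cancel, translate_zero, translate_zero] at this

/-- Translation commutes with union. [cite: AdamsBuchholzKoteckyMuller2019, Ch. 6.2] -/
theorem translate_union (a : Fin d → ZMod M) (X Y : Finset (Fin d → ZMod M)) :
    translate a (X ∪ Y) = translate a X ∪ translate a Y := by
  ext y; simp [mem_translate]

/-- Translation commutes with set difference. [cite: AdamsBuchholzKoteckyMuller2019, Ch. 6.2] -/
theorem translate_sdiff (a : Fin d → ZMod M) (X Y : Finset (Fin d → ZMod M)) :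
    translate a (X \ Y) = translate a X \ translate a Y := by
  ext y; simp [mem_translate]

/-- Translation preserves inclusion. [cite: AdamsBuchholzKoteckyMuller2019, Ch. 6.2] -/
theorem translate_subset_translate_iff {a : Fin d → ZMod M} {X Y : Finset (Fin d → ZMod M)} :
    translate a X ⊆ translate a Y ↔ X ⊆ Y := by
  constructor
  · intro h x hx
    have := h (add_mem_translate_iff.2 hx)
    exact add_mem_translate_iff.1 this
  · intro h y hy
    exact mem_translate.2 (h (mem_translate.1 hy))

/-- Translation preserves cardinality. [cite: AdamsBuchholzKoteckyMuller2019, Ch. 6.2] -/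
theorem card_translate (a : Fin d → ZMod M) (X : Finset (Fin d → ZMod M)) : (translate a X).card = X.card :=
  card_image_of_injective _ (add_left_injective a)

/-- Translation commutes with `biUnion`. [cite: AdamsBuchholzKoteckyMuller2019, Ch. 6.2] -/
theorem translate_biUnion {ι : Type*} (a : Fin d → ZMod M) (S : Finset ι) (f : ι → Finset (Fin d → ZMod M)) :
    translate a (S.biUnion f) = S.biUnion fun i => translate a (f i) := by
  ext y; simp [mem_translate]

/-- `sup`-distances are translation invariant: `(x + a) − (y + a) = x − y`.
[cite: AdamsBuchholzKoteckyMuller2019, Ch. 6.2] -/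
theorem supNorm_add_sub_add (x y a : Fin d → ZMod M) :
    GradientFRD.supNorm ((x + a) - (y + a)) = GradientFRD.supNorm (x - y) := by
  rw [add_sub_add_right_eq_sub]

/-- `ℓ^∞`-adjacency is translation invariant. [cite: AdamsBuchholzKoteckyMuller2019, Ch. 6.2] -/
theorem adjInf_add_iff {x y : Fin d → ZMod M} (a : Fin d → ZMod M) :
    AdjInf (x + a) (y + a) ↔ AdjInf x y := by
  unfold AdjInf
  simp only [Pi.add_apply, add_left_injective a |>.ne_iff]
  refine and_congr Iff.rfl (forall_congr' fun i => ?_)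
  constructor
  · rintro (h | h | h)
    · exact Or.inl (add_right_cancel h)
    · exact Or.inr (Or.inl (add_right_cancel (by rw [h]; ring)))
    · exact Or.inr (Or.inr (add_right_cancel (by rw [h]; ring)))
  · rintro (h | h | h)
    · exact Or.inl (by rw [h])
    · exact Or.inr (Or.inl (by rw [h]; ring))
    · exact Or.inr (Or.inr (by rw [h]; ring))

/-- Paths translate. [cite: AdamsBuchholzKoteckyMuller2019, Ch. 6.2] -/
theorem connIn_translate {X : Finset (Fin d → ZMod M)} {x y : Fin d → ZMod M} (h : ConnIn X x y)
    (a : Fin d → ZMod M) : ConnIn (translate a X) (x + a) (y + a) := by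
  unfold ConnIn at h ⊢
  induction h with
  | refl => exact Relation.ReflTransGen.refl
  | tail _ hbc ih =>
    exact ih.tail ⟨add_mem_translate_iff.2 hbc.1, add_mem_translate_iff.2 hbc.2.1,
      (adjInf_add_iff a).2 hbc.2.2⟩

/-- `ConnIn (X + a) (x + a) (y + a) ↔ ConnIn X x y`. [cite: AdamsBuchholzKoteckyMuller2019, Ch. 6.2] -/
theorem connIn_translate_iff {X : Finset (Fin d → ZMod M)} {x y : Fin d → ZMod M} (a : Fin d → ZMod M) :
    ConnIn (translate a X) (x + a) (y + a) ↔ ConnIn X x y := by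
  refine ⟨fun h => ?_, fun h => connIn_translate h a⟩
  have := connIn_translate h (-a)
  simp only [translate_translate, add_neg_cancel, translate_zero, add_neg_cancel_right] at this
  exact this

/-- **Connectedness is translation invariant.** [cite: AdamsBuchholzKoteckyMuller2019, Ch. 6.2] -/
theorem isConn_translate {X : Finset (Fin d → ZMod M)} (h : IsConn X) (a : Fin d → ZMod M) :
    IsConn (translate a X) := by
  refine ⟨?_, fun x hx y hy => ?_⟩
  · obtain ⟨x, hx⟩ := h.1; exact ⟨x + a, add_mem_translate_iff.2 hx⟩
  · have := connIn_translate (h.2 (x - a) (mem_translate.1 hx) (y - a) (mem_translate.1 hy)) a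
    simpa using this

/-- Components translate: `comp (X + a) (x + a) = comp X x + a`. [cite: AdamsBuchholzKoteckyMuller2019, Ch. 6.2] -/
theorem comp_translate (X : Finset (Fin d → ZMod M)) (x a : Fin d → ZMod M) :
    comp (translate a X) (x + a) = translate a (comp X x) := by
  ext y
  rw [mem_comp, mem_translate, mem_translate, mem_comp]
  have : ConnIn (translate a X) (x + a) y ↔ ConnIn X x (y - a) := by
    conv_lhs => rw [← sub_add_cancel y a]
    exact connIn_translate_iff a
  rw [this]

/-- The set of components translates. [cite: AdamsBuchholzKoteckyMuller2019, Ch. 6.2] -/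
theorem components_translate (X : Finset (Fin d → ZMod M)) (a : Fin d → ZMod M) :
    components (translate a X) = (components X).image (translate a) := by
  show (translate a X).image (comp (translate a X)) = (X.image (comp X)).image (translate a)
  rw [image_image]
  conv_lhs => rw [translate, image_image]
  exact image_congr fun x _ => by
    simp only [Function.comp_apply]
    exact comp_translate X x a

/-! ## Block-lattice translations -/

/-- `a ∈ (sℤ)^d` on the torus: every coordinate is (the residue of) a multiple of `s`
(the translations `τ_a`, `a ∈ (L^kℤ)^d`, of [ABKM19] Ch. 6.2). [cite: AdamsBuchholzKoteckyMuller2019, Ch. 6.2] -/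
def IsLatticeVec (s : ℕ) (a : Fin d → ZMod M) : Prop :=
  ∀ i, ∃ n : ℤ, a i = ((s * n : ℤ) : ZMod M)

/-- `0 ∈ (sℤ)^d`. [cite: AdamsBuchholzKoteckyMuller2019, Ch. 6.2] -/
theorem isLatticeVec_zero (s : ℕ) : IsLatticeVec s (0 : Fin d → ZMod M) :=
  fun _ => ⟨0, by simp⟩

/-- `(sℤ)^d` is closed under addition. [cite: AdamsBuchholzKoteckyMuller2019, Ch. 6.2] -/
theorem IsLatticeVec.add {s : ℕ} {a b : Fin d → ZMod M} (ha : IsLatticeVec s a) (hb : IsLatticeVec s b) :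
    IsLatticeVec s (a + b) := by
  intro i
  obtain ⟨n, hn⟩ := ha i
  obtain ⟨m, hm⟩ := hb i
  exact ⟨n + m, by rw [Pi.add_apply, hn, hm]; push_cast; ring⟩

/-- `(sℤ)^d` is closed under negation. [cite: AdamsBuchholzKoteckyMuller2019, Ch. 6.2] -/
theorem IsLatticeVec.neg {s : ℕ} {a : Fin d → ZMod M} (ha : IsLatticeVec s a) : IsLatticeVec s (-a) := by
  intro i
  obtain ⟨n, hn⟩ := ha i
  exact ⟨-n, by rw [Pi.neg_apply, hn]; push_cast; ring⟩

/-- `(s'ℤ)^d ⊆ (sℤ)^d` for `s ∣ s'` (coarser translations are finer translations).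
[cite: AdamsBuchholzKoteckyMuller2019, Ch. 6.2] -/
theorem IsLatticeVec.of_dvd {s s' : ℕ} (h : s ∣ s') {a : Fin d → ZMod M} (ha : IsLatticeVec s' a) :
    IsLatticeVec s a := by
  intro i
  obtain ⟨n, hn⟩ := ha i
  obtain ⟨q, rfl⟩ := h
  exact ⟨q * n, by rw [hn]; push_cast; ring⟩

/-- **A non-zero vector of `(sℤ)^d` has `|a|_∞ ≥ s`** (`M = s·t`: the residues of multiples of
`s` have symmetric representatives that are multiples of `s`).
[cite: AdamsBuchholzKoteckyMuller2019, Ch. 6.2] -/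
theorem le_supNorm_of_isLatticeVec [NeZero M] {s t : ℕ} (hMst : M = s * t) {a : Fin d → ZMod M}
    (ha : IsLatticeVec s a) (ha0 : a ≠ 0) : s ≤ GradientFRD.supNorm a := by
  obtain ⟨i, hi⟩ : ∃ i, a i ≠ 0 := by
    by_contra h; push Not at h; exact ha0 (funext h)
  obtain ⟨n, hn⟩ := ha i
  refine le_trans ?_ (natAbs_valMinAbs_le_supNorm a i)
  set w := (a i).valMinAbs with hw
  have h1 : ((w : ℤ) : ZMod M) = ((s * n : ℤ) : ZMod M) := by rw [hw, ZMod.coe_valMinAbs, hn]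
  rw [ZMod.intCast_eq_intCast_iff_dvd_sub] at h1
  have h2 : (s : ℤ) ∣ w := by
    have h3 : (s : ℤ) ∣ (M : ℤ) := ⟨t, by rw [hMst]; push_cast; ring⟩
    have h4 : (s : ℤ) ∣ s * n - w := h3.trans h1
    have h5 : (s : ℤ) ∣ s * n := dvd_mul_right _ _
    have := (Int.dvd_sub h5 h4)
    simpa using this
  have hw0 : w ≠ 0 := fun h => hi (ZMod.valMinAbs_eq_zero _ |>.1 h)
  obtain ⟨q, hq⟩ := h2
  have hq0 : q ≠ 0 := by rintro rfl; simp at hq; exact hw0 hq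
  rw [hq, Int.natAbs_mul]
  simp only [Int.natAbs_natCast]
  exact Nat.le_mul_of_pos_right s (Int.natAbs_pos.2 hq0)

/-- **The block index under a lattice translation** (`M = s·t`, `s, t` odd): translating by
`s·n` in one coordinate sends the block index `b` to the symmetric representative of `b + n`
modulo `t` — whole blocks go to whole blocks. [cite: AdamsKoteckyMuller2016, Ch. 4] -/
theorem resIndex_add_latticeVec [NeZero M] {s t : ℕ} (hMst : M = s * t) (hs : Odd s) (ht : Odd t)
    (v : ZMod M) (n : ℤ) :
    resIndex s (v + ((s * n : ℤ) : ZMod M)) = (((resIndex s v + n : ℤ) : ZMod t)).valMinAbs := by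
  haveI : NeZero t := ⟨by rintro rfl; simp at hMst; exact NeZero.ne M hMst⟩
  obtain ⟨h, hs'⟩ := hs
  set b := resIndex s v with hb
  set c := (((b + n : ℤ) : ZMod t)).valMinAbs with hc
  have hbv := (resIndex_eq_iff ⟨h, hs'⟩ v b).1 rfl
  have hh : (((s : ℤ)) - 1) / 2 = h := by rw [hs']; push_cast; omega
  rw [hh] at hbv
  -- `c ≡ b + n (mod t)`, `|c| ≤ (t−1)/2`
  have hct : ((c : ℤ) : ZMod t) = ((b + n : ℤ) : ZMod t) := by rw [hc, ZMod.coe_valMinAbs]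
  rw [ZMod.intCast_eq_intCast_iff_dvd_sub] at hct
  obtain ⟨m, hm⟩ := hct
  have hcabs := natAbs_valMinAbs_le_half ht (((b + n : ℤ) : ZMod t))
  rw [← hc] at hcabs
  have htm : (((t : ℤ)) - 1) / 2 = (((t - 1) / 2 : ℕ) : ℤ) := by
    obtain ⟨m', rfl⟩ := ht; push_cast; omega
  -- the representative of `v + s n`
  have hMz : (M : ℤ) = s * t := by rw [hMst]; push_cast; ring
  set u : ℤ := v.valMinAbs + s * (c - b) with hu
  have huz : (v + ((s * n : ℤ) : ZMod M)) = ((u : ℤ) : ZMod M) := by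
    have e1 : u = v.valMinAbs + s * n - (M : ℤ) * m := by
      have : (c : ℤ) - b = n - t * m := by linarith
      rw [hu, this, hMz]; ring
    rw [e1]; push_cast; rw [ZMod.natCast_self, zero_mul, sub_zero]
  have hurange : |u| ≤ ((M : ℤ) - 1) / 2 := by
    have hM' : ((M : ℤ) - 1) / 2 = s * (((t : ℤ) - 1) / 2) + h := by
      obtain ⟨m', hm'⟩ := ht
      have e2 : (((t : ℤ)) - 1) / 2 = m' := by rw [hm']; push_cast; omega
      have e3 : (M : ℤ) - 1 = 2 * (s * m' + h) := by
        rw [hMz, hs', hm']; push_cast; ring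
      rw [e2, e3, Int.mul_ediv_cancel_left _ (by norm_num : (2 : ℤ) ≠ 0)]
    rw [hM', abs_le, htm]
    have hcle : |c| ≤ (((t - 1) / 2 : ℕ) : ℤ) := by
      have : (c.natAbs : ℤ) ≤ (((t - 1) / 2 : ℕ) : ℤ) := by exact_mod_cast hcabs
      rwa [Int.natCast_natAbs] at this
    rw [abs_le] at hcle
    have hs0 : (0 : ℤ) ≤ s := by positivity
    constructor <;> nlinarith
  have hval : (v + ((s * n : ℤ) : ZMod M)).valMinAbs = u := by
    rw [huz]; exact valMinAbs_intCast_of_abs_le hurange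
  rw [resIndex_eq_iff ⟨h, hs'⟩, hval, hh]
  constructor <;> nlinarith

/-- **`B_{x+a} = B_x + a`** for `a ∈ (sℤ)^d` (`M = s·t`, `s, t` odd): the paving is invariant under
the block lattice. [cite: AdamsBuchholzKoteckyMuller2019, Ch. 6.2] -/
theorem sameBlock_add_iff [NeZero M] {s t : ℕ} (hMst : M = s * t) (hs : Odd s) (ht : Odd t)
    {a : Fin d → ZMod M} (ha : IsLatticeVec s a) (x y : Fin d → ZMod M) :
    SameBlock s (x + a) (y + a) ↔ SameBlock s x y := by
  haveI : NeZero t := ⟨by rintro rfl; simp at hMst; exact NeZero.ne M hMst⟩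
  refine forall_congr' fun i => ?_
  obtain ⟨n, hn⟩ := ha i
  rw [cubeIndex_eq_resIndex, cubeIndex_eq_resIndex, cubeIndex_eq_resIndex, cubeIndex_eq_resIndex,
    Pi.add_apply, Pi.add_apply, hn, resIndex_add_latticeVec hMst hs ht, resIndex_add_latticeVec hMst hs ht]
  constructor
  · intro h
    have h1 := congrArg (fun z : ℤ => (z : ZMod t)) h
    simp only [ZMod.coe_valMinAbs, Int.cast_add, add_left_inj] at h1
    rw [ZMod.intCast_eq_intCast_iff_dvd_sub] at h1
    -- both indices lie in `[−(t−1)/2, (t−1)/2]`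
    have hx := abs_resIndex_le hMst hs ht (x i)
    have hy := abs_resIndex_le hMst hs ht (y i)
    obtain ⟨m, hm⟩ := h1
    rw [abs_le] at hx hy
    have htt : 2 * ((((t : ℤ)) - 1) / 2) = t - 1 := by obtain ⟨m', rfl⟩ := ht; push_cast; omega
    have ht0 : (0 : ℤ) ≤ t := by positivity
    have : m = 0 := by
      rcases lt_trichotomy m 0 with hm0 | hm0 | hm0
      · have : (t : ℤ) * m ≤ -t := by nlinarith
        linarith
      · exact hm0
      · have : (t : ℤ) ≤ t * m := by nlinarith
        linarith
    subst this
    linarith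
  · intro h; rw [h]

/-- `B_{x+a} = B_x + a` for `a ∈ (sℤ)^d`. [cite: AdamsBuchholzKoteckyMuller2019, Ch. 6.2] -/
theorem blockOf_add [NeZero M] {s t : ℕ} (hMst : M = s * t) (hs : Odd s) (ht : Odd t)
    {a : Fin d → ZMod M} (ha : IsLatticeVec s a) (x : Fin d → ZMod M) :
    blockOf s (x + a) = translate a (blockOf s x) := by
  ext y
  rw [mem_blockOf, mem_translate, mem_blockOf]
  conv_lhs => rw [← sub_add_cancel y a]
  exact sameBlock_add_iff hMst hs ht ha x (y - a)

/-- **Translates of polymers by the block lattice are polymers.**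
[cite: AdamsBuchholzKoteckyMuller2019, Ch. 6.2] -/
theorem isPolymer_translate [NeZero M] {s t : ℕ} (hMst : M = s * t) (hs : Odd s) (ht : Odd t)
    {a : Fin d → ZMod M} (ha : IsLatticeVec s a) {X : Finset (Fin d → ZMod M)} (hX : IsPolymer s X) :
    IsPolymer s (translate a X) := by
  intro y hy
  have hy' := mem_translate.1 hy
  have : blockOf s y = translate a (blockOf s (y - a)) := by
    conv_lhs => rw [← sub_add_cancel y a]
    exact blockOf_add hMst hs ht ha (y - a)
  rw [this, translate_subset_translate_iff]
  exact hX _ hy'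

/-- `𝓑_k(X + a) = {B + a : B ∈ 𝓑_k(X)}` for `a ∈ (sℤ)^d`. [cite: AdamsBuchholzKoteckyMuller2019, Ch. 6.2] -/
theorem blocks_translate [NeZero M] {s t : ℕ} (hMst : M = s * t) (hs : Odd s) (ht : Odd t)
    {a : Fin d → ZMod M} (ha : IsLatticeVec s a) (X : Finset (Fin d → ZMod M)) :
    blocks s (translate a X) = (blocks s X).image (translate a) := by
  rw [blocks, translate, image_image, blocks, image_image]
  exact image_congr fun x _ => by simp [Function.comp, blockOf_add hMst hs ht ha]

/-- `|𝓑_k(X + a)| = |𝓑_k(X)|` for `a ∈ (sℤ)^d`. [cite: AdamsBuchholzKoteckyMuller2019, Ch. 6.2] -/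
theorem card_blocks_translate [NeZero M] {s t : ℕ} (hMst : M = s * t) (hs : Odd s) (ht : Odd t)
    {a : Fin d → ZMod M} (ha : IsLatticeVec s a) (X : Finset (Fin d → ZMod M)) :
    (blocks s (translate a X)).card = (blocks s X).card := by
  rw [blocks_translate hMst hs ht ha, card_image_of_injective _ fun Y Z h => translate_inj h]

/-- The closure `X̄` commutes with translations of the coarse lattice: for `a ∈ (s'ℤ)^d`,
`closure s' (X + a) = closure s' X + a`. [cite: AdamsBuchholzKoteckyMuller2019, Ch. 6.3 (6.25)] -/
theorem closure_translate [NeZero M] {s' t' : ℕ} (hMst : M = s' * t') (hs : Odd s') (ht : Odd t')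
    {a : Fin d → ZMod M} (ha : IsLatticeVec s' a) (X : Finset (Fin d → ZMod M)) :
    closure s' (translate a X) = translate a (closure s' X) := by
  ext y
  rw [mem_closure, mem_translate, mem_closure]
  constructor
  · rintro ⟨x, hx, hxy⟩
    refine ⟨x - a, mem_translate.1 hx, ?_⟩
    have := (sameBlock_add_iff hMst hs ht ha (x - a) (y - a)).1
    simp only [sub_add_cancel] at this
    exact this hxy
  · rintro ⟨x, hx, hxy⟩
    refine ⟨x + a, add_mem_translate_iff.2 hx, ?_⟩
    have := (sameBlock_add_iff hMst hs ht ha x (y - a)).2 hxy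
    simpa using this

end Literature.MathematicalPhysics.StatisticalMechanics.TorusPolymer

end
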